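import Mathlib
import Literature.Geometry.Lorentzian.KerrConvergence
import Summits.FinalStateConjecture.FinalStateConjecture.Theorems.EIHFluxBalanceModulatedKerrHandoffAnnulusRigidityLorentzNewton
import Summits.FinalStateConjecture.FinalStateConjecture.Theorems.EIHFluxBalanceModulatedKerrHandoffAnnulusRigidityChristoffel
import Summits.FinalStateConjecture.FinalStateConjecture.Theorems.EIHFluxBalanceModulatedKerrHandoffAnnulusRigidityPaths

/-!
# Route EIHFluxBalance — `ModulatedKerrHandoff`: stub `stub_annulusRigidity` (rigidity of the Minkowski annulus)

Crux `stmt-FinalStateConjecture-10167`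
(`Summit.FinalStateConjecture.FinalStateConjecture.Theses.EIHFluxBalance.ModulatedKerrHandoff`), line
`overlap-modulation-second-iterate`, registered stub `stub_annulusRigidity` (S1 of the lead skeleton
`Lines/overlap_modulation_second_iterate.lean`): the RIGIDITY ENGINE of the chart synthesis. For every
bound `Γ` on `‖Dψ‖` there are `C, ε₀ > 0` (here `C = 4880 Γ`, `ε₀ = 1/2`) such that a `C²` map `ψ`
of the Euclidean annulus `A_R = {R < ‖x‖ < 4R} ⊆ E4` with `‖Dψ‖ ≤ Γ`, metric defect
`‖ψ^*η − η‖ ≤ ε ≤ ε₀` and `‖D(ψ^*η)‖ ≤ ε/R` on `A_R` (Euclidean operator norms) is `Cε`-close in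
`C¹` and `CεR`-close in `C⁰` to a Poincaré map `x ↦ Lx + c`, `L ∈ O(1,3)`.

Proof (the lead's route, files `…AnnulusRigidity*`):
(b) CHRISTOFFEL IDENTITY (`…Christoffel`): `‖D²ψ(x)‖ ≤ 3Γ · ε/R` on `A_R` from the symmetry of
`D²ψ` and `2η(D²ψ(u,v), Dψ w) = Dg(u)(v,w) + Dg(v)(u,w) − Dg(w)(u,v)`, `g = ψ^*η`, using the
quantitative invertibility of `Dψ` (`…MinkowskiNorm`: `η♭` is a Euclidean isometry, so
`(1 − ε)‖v‖ ≤ Γ‖Dψ v‖`);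
(c) PATHS (`…Paths`): any two points of `A_R` are joined inside `A_R` by five segments of length
`≤ 8R`, so the mean value inequality gives `‖Dψ(x) − Dψ(x₀)‖ ≤ 40R · 3Γε/R = 120Γε`
(`x₀ = 2R e₀`);
(d) NEAREST LORENTZ MAP (`…LorentzNewton`): the Newton–Schulz iteration for the `η`-polar factor of
`B = Dψ(x₀)` converges to `L ∈ lorentzGroup` with `‖B − L‖ ≤ 2Γε`;
(e) hence `‖Dψ − L‖ ≤ 122Γε` on `A_R`, and the mean value inequality for `ψ − L` along the same
paths gives `‖ψ(x) − Lx − c‖ ≤ 40R · 122Γε`, `c = ψ(x₀) − Lx₀`.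
O'Neill 1983, Ch. 3 (local isometries of `ℝ⁴₁` are affine); Friesecke–James–Müller 2002 for the
quantitative paradigm (trivial here since `C¹` control of the metric defect is given). [folklore]
-/

-- `Summit.<S>.<S>.…` (single-problem summit, D-0017) trips core's duplicate-namespace linter.
set_option linter.dupNamespace false
-- the operator-norm instance path on trilinear-form-valued maps needs one more pending level
set_option maxSynthPendingDepth 3

noncomputable section

namespace Summit.FinalStateConjecture.FinalStateConjecture.Cruxes.ModulatedKerrHandoff.OverlapModulationSecondIterate

open scoped Manifold ContDiff Topology BigOperators ENNReal
open Set Function Filter TopologicalSpace Literature.Geometry.Lorentzian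
open Summit.FinalStateConjecture.FinalStateConjecture.Theorems

/-- **STUB S1 · `stub_annulusRigidity` (the rigidity engine of the synthesis).** For every bound
`Γ` on `‖Dψ‖` there are `C, ε₀ > 0` such that: a `C²` map `ψ` of the Minkowski annulus
`A_R = {R < ‖x‖ < 4R} ⊆ E4` (Euclidean norm) with `‖Dψ‖ ≤ Γ`, metric defect `‖ψ^*η − η‖ ≤ ε ≤ ε₀`
and `‖D(ψ^*η)‖ ≤ ε/R` on `A_R` is `Cε`-close in `C¹` and `CεR`-close in `C⁰` to a Poincaré map
`x ↦ Λx + c`, uniformly in `R` (`C = 4880Γ`, `ε₀ = 1/2`). [folklore] -/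
theorem stub_annulusRigidity :
    ∀ Γ : ℝ, 0 < Γ → ∃ C ε₀ : ℝ, 0 < C ∧ 0 < ε₀ ∧
        ∀ (R ε : ℝ) (ψ : E4 → E4), 0 < R → 0 ≤ ε → ε ≤ ε₀ →
          ContDiffOn ℝ 2 ψ {x : E4 | R < ‖x‖ ∧ ‖x‖ < 4 * R} →
          (∀ x : E4, R < ‖x‖ ∧ ‖x‖ < 4 * R →
            ‖fderiv ℝ ψ x‖ ≤ Γ ∧
              ‖Minkowski.bilin.bilinearComp (fderiv ℝ ψ x) (fderiv ℝ ψ x) - Minkowski.bilin‖ ≤ ε ∧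
              ‖fderiv ℝ (fun y ↦ Minkowski.bilin.bilinearComp (fderiv ℝ ψ y) (fderiv ℝ ψ y)) x‖ ≤ ε / R) →
          ∃ (L : lorentzGroup) (c : E4), ∀ x : E4, R < ‖x‖ ∧ ‖x‖ < 4 * R →
            ‖fderiv ℝ ψ x - ((L : E4 ≃L[ℝ] E4) : E4 →L[ℝ] E4)‖ ≤ C * ε ∧
              ‖ψ x - ((L : E4 ≃L[ℝ] E4) x + c)‖ ≤ C * ε * R := by
  intro Γ hΓ
  refine ⟨4880 * Γ, 1 / 2, by positivity, by norm_num, ?_⟩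
  intro R ε ψ hR hε hε₀ hψ hH
  have hA : IsOpen {x : E4 | R < ‖x‖ ∧ ‖x‖ < 4 * R} :=
    (isOpen_lt continuous_const continuous_norm).inter (isOpen_lt continuous_norm continuous_const)
  have hcd : ∀ x : E4, R < ‖x‖ ∧ ‖x‖ < 4 * R → ContDiffAt ℝ 2 ψ x :=
    fun x hx ↦ hψ.contDiffAt (hA.mem_nhds hx)
  -- (b) second derivatives from the Christoffel identity
  have hD2 : ∀ x : E4, R < ‖x‖ ∧ ‖x‖ < 4 * R → ‖fderiv ℝ (fderiv ℝ ψ) x‖ ≤ 3 * Γ * (ε / R) :=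
    fun x hx ↦ AnnulusRigidity.norm_fderiv_fderiv_le (hcd x hx) (hH x hx).1 (hH x hx).2.1 hε₀
      (hH x hx).2.2
  have hdf : ∀ x : E4, R < ‖x‖ ∧ ‖x‖ < 4 * R → DifferentiableAt ℝ (fderiv ℝ ψ) x :=
    fun x hx ↦ ((hcd x hx).fderiv_right (m := 1) (by norm_num)).differentiableAt one_ne_zero
  -- the base point `x₀ = 2R e₀`
  set x₀ : E4 := EuclideanSpace.single 0 (2 * R) with hx₀
  have hx₀A : R < ‖x₀‖ ∧ ‖x₀‖ < 4 * R := by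
    rw [hx₀, PiLp.norm_single, Real.norm_of_nonneg (by linarith)]
    constructor <;> linarith
  -- (c) oscillation of `Dψ` along paths in the annulus
  have hosc : ∀ x : E4, R < ‖x‖ ∧ ‖x‖ < 4 * R → ‖fderiv ℝ ψ x - fderiv ℝ ψ x₀‖ ≤ 120 * Γ * ε := by
    intro x hx
    calc ‖fderiv ℝ ψ x - fderiv ℝ ψ x₀‖ ≤ 40 * R * (3 * Γ * (ε / R)) :=
          AnnulusRigidity.norm_sub_le_of_norm_fderiv_le hR hdf hD2 hx hx₀A
      _ = 120 * Γ * ε := by field_simp; ring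
  -- (d) the nearest Lorentz transformation to `Dψ(x₀)`
  obtain ⟨L, hL⟩ :=
    AnnulusRigidity.exists_lorentz_norm_sub_le (hH x₀ hx₀A).1 (hH x₀ hx₀A).2.1 hε₀
  -- (e) conclusion
  have hC1 : ∀ x : E4, R < ‖x‖ ∧ ‖x‖ < 4 * R →
      ‖fderiv ℝ ψ x - ((L : E4 ≃L[ℝ] E4) : E4 →L[ℝ] E4)‖ ≤ 122 * Γ * ε := fun x hx ↦
    calc ‖fderiv ℝ ψ x - ((L : E4 ≃L[ℝ] E4) : E4 →L[ℝ] E4)‖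
        ≤ ‖fderiv ℝ ψ x - fderiv ℝ ψ x₀‖ +
            ‖fderiv ℝ ψ x₀ - ((L : E4 ≃L[ℝ] E4) : E4 →L[ℝ] E4)‖ :=
          norm_sub_le_norm_sub_add_norm_sub _ _ _
      _ ≤ 120 * Γ * ε + 2 * Γ * ε := add_le_add (hosc x hx) hL
      _ = 122 * Γ * ε := by ring
  refine ⟨L, ψ x₀ - (L : E4 ≃L[ℝ] E4) x₀, fun x hx ↦ ⟨(hC1 x hx).trans (by nlinarith), ?_⟩⟩
  have hgd : ∀ z : E4, R < ‖z‖ ∧ ‖z‖ < 4 * R →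
      DifferentiableAt ℝ (fun y ↦ ψ y - (L : E4 ≃L[ℝ] E4) y) z := fun z hz ↦
    ((hcd z hz).differentiableAt two_ne_zero).sub (L : E4 ≃L[ℝ] E4).differentiableAt
  have hgM : ∀ z : E4, R < ‖z‖ ∧ ‖z‖ < 4 * R →
      ‖fderiv ℝ (fun y ↦ ψ y - (L : E4 ≃L[ℝ] E4) y) z‖ ≤ 122 * Γ * ε := fun z hz ↦ by
    rw [fderiv_fun_sub ((hcd z hz).differentiableAt two_ne_zero) (L : E4 ≃L[ℝ] E4).differentiableAt,
      ContinuousLinearEquiv.fderiv]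
    exact hC1 z hz
  calc ‖ψ x - ((L : E4 ≃L[ℝ] E4) x + (ψ x₀ - (L : E4 ≃L[ℝ] E4) x₀))‖
      = ‖(ψ x - (L : E4 ≃L[ℝ] E4) x) - (ψ x₀ - (L : E4 ≃L[ℝ] E4) x₀)‖ := by
        congr 1; abel
    _ ≤ 40 * R * (122 * Γ * ε) := AnnulusRigidity.norm_sub_le_of_norm_fderiv_le hR hgd hgM hx hx₀A
    _ = 4880 * Γ * ε * R := by ring

end Summit.FinalStateConjecture.FinalStateConjecture.Cruxes.ModulatedKerrHandoff.OverlapModulationSecondIterate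

end
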